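import Summits.HubbardSuperconductivity.HubbardLadder.PairFieldCeilingUniform
import Summits.HubbardSuperconductivity.HubbardLadder.PairFieldCeilingListCert
import HarnessLib

/-!
# Rungs R3/R4 — uniform ceilings, part 4: block ceilings and the edge to H⁻ from LIST certificates

HONEST FRAMING (page 1): ladder R1–R4 with certified numbers; no claim on H/H₀. EDGES only; no
certificate of the kind consumed here has been computed. Fourth part of the split of
`PairFieldCeilingUniform.lean` (§7b): `UpperBlockListCertTT'` (a nonempty block `S`, a list `(w_i, r_i)`
representing `S − S` with multiplicities, ONE `PairListCertTT'` for the UPPER list objective, density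
offset `(1 − δ)/2`, energy ceiling above the TL density) ⇒ `UniformPairFieldCeilingCert` with
`ε = −q/|S|²` (block Cauchy–Schwarz of part 1); the list-representation lemmas `hrep_single` / `hrep_pair`;
the headline data type `R4CeilingListCert t'` at `(1, t', 8)`, `δ = 1/8` and its consequences; the edge
`noDWaveOrderPureU8Eighth_of_ceilingListCerts`. Every hypothesis is a binder or a structure field.
-/

namespace Summit.HubbardSuperconductivity.HubbardLadder

open Matrix Finset Filter Literature.Probability.LatticeModels
  Literature.MathematicalPhysics.QuantumLattice
open Literature.MathematicalPhysics.QuantumLattice.ThermodynamicLimit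
open Literature.MathematicalPhysics.QuantumManyBody.StateRelaxation
open scoped ComplexOrder Topology

noncomputable section

/-- **R3-∞ upper-block data from ONE list certificate** in the `t–t'` model at doping `δ`: a nonempty
block `S`, a list `(w_i, r_i)` representing the block's displacement multiset
(`Σ_{s,s' ∈ S} F(s' − s) = Σ_i w_i F(r_i)` for every `F` — e.g. the distinct displacements of `S − S`
with their multiplicities, the producer's reduced list), ONE translation-invariant certificate for the
UPPER list objective `−Σ_i w_i Δ_0† Δ_{r_i}`, the density offset `ν = (1 − δ)/2` and an energy ceiling
strictly above the TL energy density. Certificate data only. [cite: WangEtAl2024, §III] -/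
structure UpperBlockListCertTT' (t t' U δ : ℝ) where
  /-- the block -/
  S : Finset (Site 2)
  hS : S.Nonempty
  /-- the list: weights and displacements -/
  n : ℕ
  w : Fin n → ℝ
  r : Fin n → Site 2
  /-- the list represents the block's displacement multiset -/
  hrep : ∀ F : Site 2 → ℝ, ∑ s ∈ S, ∑ s' ∈ S, F (s' - s) = ∑ i, w i * F (r i)
  /-- the upper certificate for the list objective -/
  C : PairListCertTT' t t' U n (fun i => -w i) r
  /-- density offset of doping `δ` -/
  hν : C.ν = (1 - δ) / 2
  /-- its energy ceiling lies strictly above the TL energy density -/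
  hu : energyDensityTT' t t' U (1 - δ) < C.u

namespace UpperBlockListCertTT'

variable {t t' U δ : ℝ}

/-- The certified ceiling constant `E = −q / |S|²`. [folklore] -/
def E (B : UpperBlockListCertTT' t t' U δ) : ℝ := -B.C.q / (#B.S : ℝ) ^ 2

/-- **What one list certificate certifies, uniformly in `L`.** For `U ≥ 0`, `-1 < δ ≤ 1` and every
`a > −q`: `Σ_{s,s' ∈ S} P̄_d(L, s' − s; ψ) ≤ a` for EVERY unit ground state `ψ` of the sector
`(electronNumber δ L, S^z = 0)` of `hubbardTorusTT' L t t' U` on EVERY side `L ≥ L₁`.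
[cite: WangEtAl2024, §III] -/
theorem sum_avgPairCorr_le_eventually (B : UpperBlockListCertTT' t t' U δ) (hU : 0 ≤ U) (hδ0 : -1 < δ)
    (hδ1 : δ ≤ 1) {a : ℝ} (ha : -B.C.q < a) :
    ∃ L₁ : ℕ, ∀ L : ℕ, L₁ ≤ L → ∀ ψ : Fock (Orb (FermionTorus 2 L)), star ψ ⬝ᵥ ψ = 1 →
      IsGroundStateInSector (hubbardTorusTT' L t t' U) (electronNumber δ L) 0 ψ →
        ∑ s ∈ B.S, ∑ s' ∈ B.S, avgPairCorr L (s' - s) ψ ≤ a := by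
  obtain ⟨L₀, hL₀⟩ := uniformEnergyCeiling_of_energyDensityTT'_lt (t := t) (t' := t') hU hδ0 hδ1 B.hu
  obtain ⟨Lq, hLq⟩ := B.C.bound_ge_eventually hδ1 B.hν (b := -a) (by linarith)
  obtain ⟨La, hLa⟩ := exists_forall_le_injOn_proj (thicken B.C.Λ' 1)
  refine ⟨max 3 (max L₀ (max Lq La)), fun L hL ψ h1 hgs => ?_⟩
  simp only [max_le_iff] at hL
  obtain ⟨h3, hL0, hLq', hLa'⟩ := hL
  obtain ⟨m, rfl⟩ : ∃ m, L = m + 1 := ⟨L - 1, by omega⟩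
  have key := B.C.bound_le_sum_avgPairCorr m h3 (hLa _ hLa') (pairNumber_le_card hδ0.le (m + 1))
    (hL₀ (m + 1) hL0) hgs h1
  have hq := hLq (m + 1) hLq'
  rw [B.hrep (fun x => avgPairCorr (m + 1) x ψ)]
  have hneg : ∑ i, -B.w i * avgPairCorr (m + 1) (B.r i) ψ = -∑ i, B.w i * avgPairCorr (m + 1) (B.r i) ψ := by
    rw [← Finset.sum_neg_distrib]
    exact Finset.sum_congr rfl fun i _ => by ring
  rw [hneg] at key
  linarith

/-- **Ceiling from one list certificate, with any margin.** For `U ≥ 0`, `-1 < δ ≤ 1` and every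
`g > 0`: a `UniformPairFieldCeilingCert` for `(hubbardTorusTT' · t t' U, electronNumber δ)` with
`ε = E + g` (block Cauchy–Schwarz §1 + `sum_avgPairCorr_le_eventually`). [cite: WangEtAl2024, §III] -/
theorem exists_ceilingCert (B : UpperBlockListCertTT' t t' U δ) (hU : 0 ≤ U) (hδ0 : -1 < δ) (hδ1 : δ ≤ 1)
    {g : ℝ} (hg : 0 < g) :
    ∃ cert : UniformPairFieldCeilingCert (fun L => hubbardTorusTT' L t t' U) (electronNumber δ),
      cert.ε = B.E + g := by
  have hS' : (0 : ℝ) < (#B.S : ℝ) := by exact_mod_cast Finset.card_pos.2 B.hS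
  have hS2 : (0 : ℝ) < (#B.S : ℝ) ^ 2 := by positivity
  obtain ⟨L₁, hL₁⟩ := B.sum_avgPairCorr_le_eventually hU hδ0 hδ1 (a := -B.C.q + g * (#B.S : ℝ) ^ 2)
    (by nlinarith)
  refine ⟨⟨B.E + g, L₁, fun L hL _ ψ h1 hgs => ?_⟩, rfl⟩
  have hcs := card_sq_mul_pairFieldDensity_le_sum_avgPairCorr B.S L ψ
  have h := hL₁ L hL ψ h1 hgs
  rw [E, div_add' _ _ _ hS2.ne', le_div_iff₀ hS2]
  linarith

/-- **What one list certificate certifies**: `limsup_k dWaveOrderParamSq ψ k ≤ E = −q/|S|²` for EVERY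
admissible ground-state sequence of `hubbardTorusTT' L t t' U` at doping `δ` (`U ≥ 0`, `-1 < δ ≤ 1`).
[cite: Scalapino1995, §2 eq. (2.4)] -/
theorem limsup_dWaveOrderParamSq_le (B : UpperBlockListCertTT' t t' U δ) (hU : 0 ≤ U) (hδ0 : -1 < δ)
    (hδ1 : δ ≤ 1) (ψ : ∀ L, Fock (Orb (FermionTorus 2 L)))
    (hψ : ∀ L, Even L → star (ψ L) ⬝ᵥ ψ L = 1 ∧
      IsGroundStateInSector (hubbardTorusTT' L t t' U) (electronNumber δ L) 0 (ψ L)) :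
    limsup (dWaveOrderParamSq ψ) atTop ≤ B.E := by
  refine le_of_forall_pos_le_add fun g hg => ?_
  obtain ⟨cert, hε⟩ := B.exists_ceilingCert hU hδ0 hδ1 hg
  exact hε ▸ cert.limsup_dWaveOrderParamSq_le ψ hψ

end UpperBlockListCertTT'

/-- The representation identity `hrep` is routine per block — the one-site block `S = {0}`: list
`[(1, 0)]`. [folklore] -/
theorem hrep_single (F : Site 2 → ℝ) :
    ∑ s ∈ ({0} : Finset (Site 2)), ∑ s' ∈ ({0} : Finset (Site 2)), F (s' - s) =
      ∑ i : Fin 1, (fun _ => (1 : ℝ)) i * F ((fun _ => (0 : Site 2)) i) := by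
  simp

/-- — and the two-site block `S = {0, e}` (`e ≠ 0`): list `[(2, 0), (1, e), (1, −e)]`. [folklore] -/
theorem hrep_pair {e : Site 2} (he : e ≠ 0) (F : Site 2 → ℝ) :
    ∑ s ∈ ({0, e} : Finset (Site 2)), ∑ s' ∈ ({0, e} : Finset (Site 2)), F (s' - s) =
      ∑ i : Fin 3, (![2, 1, 1] : Fin 3 → ℝ) i * F ((![0, e, -e] : Fin 3 → Site 2) i) := by
  rw [Finset.sum_pair he.symm, Finset.sum_pair he.symm, Finset.sum_pair he.symm]
  simp only [sub_zero, zero_sub, sub_self, Fin.sum_univ_three, Matrix.cons_val_zero, Matrix.cons_val_one,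
    Matrix.cons_val_two, Matrix.head_cons, Matrix.tail_cons]
  ring

/-- **Target-format R4 ceiling data at the headline locus from ONE list certificate (no instance
computed).** Block `S`, a representing list `(w_i, r_i)`, and one translation-invariant UPPER
certificate for `−Σ_i w_i Δ_0† Δ_{r_i}` in the model `(1, t', 8)` with `ν = 7/16` and energy ceiling
strictly above `e(1, t', 8, 7/8)`. First producible members: `S = {0}` (list `[(1, 0)]`, window class
`3 × 3`); `S = {0, e₁}` (list `[(2, 0), (1, e₁), (1, −e₁)]`) and the `2 × 2` block (9 displacements),
window class `4 × 4`. [cite: WangEtAl2024, §III] [cite: QinEtAl2020, §III.B] -/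
structure R4CeilingListCert (t' : ℝ) where
  /-- the block -/
  S : Finset (Site 2)
  hS : S.Nonempty
  /-- the list -/
  n : ℕ
  w : Fin n → ℝ
  r : Fin n → Site 2
  hrep : ∀ F : Site 2 → ℝ, ∑ s ∈ S, ∑ s' ∈ S, F (s' - s) = ∑ i, w i * F (r i)
  /-- the upper list certificate at `(1, t', 8)` -/
  C : PairListCertTT' 1 t' 8 n (fun i => -w i) r
  /-- density offset of doping `1/8` -/
  hν : C.ν = 7 / 16
  /-- energy ceiling strictly above the TL energy density -/
  hu : energyDensityTT' 1 t' 8 (7 / 8) < C.u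

namespace R4CeilingListCert

variable {t' : ℝ}

/-- The underlying upper block-list datum at doping `1/8`. [folklore] -/
def toUpperBlockList (R : R4CeilingListCert t') : UpperBlockListCertTT' 1 t' 8 (1 / 8) where
  S := R.S
  hS := R.hS
  n := R.n
  w := R.w
  r := R.r
  hrep := R.hrep
  C := R.C
  hν := by rw [R.hν]; norm_num
  hu := by have h := R.hu; norm_num at h ⊢; exact h

/-- The certified ceiling `E = −q / |S|²`. [folklore] -/
def E (R : R4CeilingListCert t') : ℝ := R.toUpperBlockList.E

/-- **What the datum certifies in the `t–t'` model**: `limsup_k dWaveOrderParamSq ψ k ≤ E` for EVERY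
admissible ground-state sequence of `hubbardTorusTT' L 1 t' 8` at doping `1/8`.
[cite: XuEtAl2024, eq. (1)] -/
theorem limsup_dWaveOrderParamSq_le (R : R4CeilingListCert t') (N : ℕ → ℕ)
    (ψ : ∀ L, Fock (Orb (FermionTorus 2 L)))
    (hNψ : ∀ L, Even L → N L = 2 * ⌊(1 - 1 / 8) * (L : ℝ) ^ 2 / 2⌋₊ ∧ star (ψ L) ⬝ᵥ ψ L = 1 ∧
      IsGroundStateInSector (hubbardTorusTT' L 1 t' 8) (N L) 0 (ψ L)) :
    limsup (dWaveOrderParamSq ψ) atTop ≤ R.E := by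
  refine R.toUpperBlockList.limsup_dWaveOrderParamSq_le (by norm_num) (by norm_num) (by norm_num) ψ
    fun L hL => ?_
  obtain ⟨hN, h1, hgs⟩ := hNψ L hL
  rw [hN] at hgs
  exact ⟨h1, hgs⟩

/-- **What the datum certifies in the PURE model (`t' = 0`)**, under the hypotheses of
`NoDWaveOrderPureU8Eighth` verbatim: `limsup_k dWaveOrderParamSq ψ k ≤ E` (a BOUND, not vanishing).
[cite: QinEtAl2020, §IV p. 11] -/
theorem limsup_dWaveOrderParamSq_le_pure (R : R4CeilingListCert 0) (N : ℕ → ℕ)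
    (ψ : ∀ L, Fock (Orb (FermionTorus 2 L)))
    (hNψ : ∀ L, Even L → N L = 2 * ⌊(1 - 1 / 8) * (L : ℝ) ^ 2 / 2⌋₊ ∧ star (ψ L) ⬝ᵥ ψ L = 1 ∧
      IsGroundStateInSector (hubbardTorus 2 L 1 8) (N L) 0 (ψ L)) :
    limsup (dWaveOrderParamSq ψ) atTop ≤ R.E := by
  refine R.limsup_dWaveOrderParamSq_le N ψ fun L hL => ?_
  rw [hubbardTorusTT'_zero]
  exact hNψ L hL

end R4CeilingListCert

/-- **Edge to H⁻ from list certificates**: for every `ε > 0` an `R4CeilingListCert 0` with `E ≤ ε`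
proves `NoDWaveOrderPureU8Eighth` (as `noDWaveOrderPureU8Eighth_of_ceilingBlockCerts`; the honest
statement of what the family could decide in the limit, not a plan). [cite: QinEtAl2020, §IV p. 11] -/
theorem noDWaveOrderPureU8Eighth_of_ceilingListCerts
    (h : ∀ ε > 0, ∃ R : R4CeilingListCert 0, R.E ≤ ε) : NoDWaveOrderPureU8Eighth := by
  intro N ψ hNψ
  have hψ : ∀ L, Even L → star (ψ L) ⬝ᵥ ψ L = 1 ∧
      IsGroundStateInSector (hubbardTorusTT' L 1 0 8) (electronNumber (1 / 8) L) 0 (ψ L) := by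
    intro L hL
    obtain ⟨hN, h1, hgs⟩ := hNψ L hL
    rw [hN] at hgs
    rw [hubbardTorusTT'_zero]
    exact ⟨h1, hgs⟩
  refine UniformPairFieldCeilingCert.tendsto_zero_of_forall (H := fun L => hubbardTorusTT' L 1 0 8)
    (N := electronNumber (1 / 8)) (fun ε hε => ?_) ψ hψ
  obtain ⟨R, hR⟩ := h (ε / 2) (half_pos hε)
  obtain ⟨cert, hc⟩ := R.toUpperBlockList.exists_ceilingCert (by norm_num) (by norm_num) (by norm_num)
    (half_pos hε)
  have hR' : R.toUpperBlockList.E ≤ ε / 2 := hR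
  exact ⟨cert, by rw [hc]; linarith⟩

end

end Summit.HubbardSuperconductivity.HubbardLadder
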